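import Mathlib.Data.Rat.Defs
import Mathlib.Algebra.Order.Field.Rat
import Mathlib.Data.List.Sort
import Mathlib.Data.List.Sublists
import Mathlib.Tactic.NormNum
import HarnessLib

/-!
# Volkov's graph-specific sampling exponents Deg(s) for graphs without lepton loops (PRD 96, 096018 (2017) §III.B; PRD 98, 076018 (2018) §III) — the combinatorial definitions typed as computable functions, and EVERY printed worked example of PRD 96 §III.B certified by `decide`

independent recomputation; certified where stated, statistical where stated; no new-physics claim.

CITATION HEADER (venture `QEDPrecision`, cell `pub-qed`; literature seat gen 21; VALUE-FREE: graph combinatorics, the printed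
definitions and the printed worked examples only — no integral, no Monte-Carlo value, nothing per Set V family; the sampler's numerical
constants (eq_mc_constants) are quoted as the paper's own algorithm parameters). Serves the IR/SE lane strand (b) (`irse/SEATS.md` §1:
the Set V sampler design reads Volkov's printed Deg construction; Set V = graphs WITHOUT lepton loops, exactly the scope of this section)
and the cell's second implementation (`pub-qed-int-2/SCHEME-NOTES.md`).
Sources. [Volkov2017] S. Volkov, "New method of computing the contributions of graphs without lepton loops to the electron anomalous
magnetic moment in QED", Phys. Rev. D 96, 096018 (2017) = arXiv:1705.05800v2, §III.B "Graph-specific probability density functions"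
(LaTeX e-print held by the cell, HOME `data/lit/sources/.cache/1705.05800/amm4_mc_arxiv.tex`, l.560–837; the four example figures
`example_cross` (FIG. 4: "3-loop fully crossed ladder"), `example_select` (FIG. 3: "overlapping UV-divergent subgraphs"), `example_chains`
(FIG. 5: "two SE-chains"), `example_operators` (FIG. 1) are in the e-print; their vertex labels a, b, c, … follow the electron path and their
printed line numbers are transcribed below — the transcription is checked by the fact that ALL printed example values come out right).
[Volkov2018] S. Volkov, Phys. Rev. D 98, 076018 (2018) = arXiv:1807.05281v2 §III (`amm4gpu_arxiv.tex` l.484–648): the same definitions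
("The following auxiliary definitions repeat the ones from [volkov_prd]") with the modified formula for Deg(s) and the constants
(eq_mc_constants), typed as `deg18`.

VERBATIM (PRD 96 §III.B). "g₀(z₁,…,z_n) = Π_{l=2}^{n} (z_{j_l}/z_{j_{l−1}})^{Deg({j_l,…,j_n})} / (z₁z₂…z_n)" on the sector z_{j₁} ≥ … ≥ z_{j_n},
"where Deg(s) > 0 is defined for each set s of internal lines of G except the empty set and the set of all internal lines of G"
(eq_mc_g0, l.587–595) · "ω(s) = 2N_L(s) + |electrons(s)|/2 − |s|, where |x| is the cardinality of a set x, electrons(s) is the set of all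
electron lines in s, N_L(s) is the number of independent loops in s. If s is the set of all internal lines of a subgraph of G, then ω(s)
coincides with the ultraviolet degree of divergence of this subgraph" (l.608–617) · "By IClos(s) we denote the set s ∪ s′, where s′ is the
set of all internal photon lines l in G such that s contains the electron path in G connecting the ends of l. The set IClos(s) is called
the I-closure of the set s." (l.619–622) · "ω′(s) = ω(IClos(s))" (l.636–639) · "A graph G″ belonging to a forest F ∈ 𝔉[G] is called a child
of a graph G′ ∈ F in F if G″ ⊊ G′, and there is no G‴ ∈ F such that G‴ ⊊ G′, G″ ⊊ G‴. If F ∈ 𝔉[G] and G′ ∈ F then by G′/F we denote the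
graph that is obtained from G′ by shrinking all childs of G′ in F to points. We also will use the symbols ω, ω′ for graphs G′ that are
constructed from G by some operations like described above and for sets s that are subsets of the set of internal lines of the whole
graph G. We will denote it by ω_{G′}(s) and ω′_{G′}(s), respectively. This means that we apply the operations ω and ω′ in the graph G′ to
the set s′ that is the intersection of s and the set of all internal lines of G′." (l.645–662) · "Electron self-energy subgraphs and lines
joining them form chains l₁G₁l₂G₂…l_rG_rl_{r+1}, where l_j are electron lines of G, G_j are electron self-energy subgraphs of G. Maximal
(with respect to inclusion) subsets {l₁,l₂,…,l_{r+1}} corresponding to such chains are called SE-chains. The set of all SE-chains of G is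
denoted by 𝔖[G]." (l.681–688) · "ω*_{G′}(s) = ω′_{G′}(s) + ½ Σ_{s′∈𝔖[G], s′⊆s, s′ in G′} (|s′| − 1) (it is important that here we consider
the SE-chains of the whole graph G)" (l.699–706) · "By 𝔉_max[G] we denote the set of all maximal forests belonging to 𝔉[G] (with respect to
inclusion)" (l.745–746) · "Let C_sat ≥ 0, C_big > 0, C_add > −C_sat be constants. By definition, put (eq_deg) Deg(s) = C_big, if s
contain all electron lines of G; C_add + max[C_sat, min_{F∈𝔉_max[G]} Σ_{G′∈F} max(0, −ω*_{G′/F}(s))] otherwise." (l.756–766) · "For a good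
Monte Carlo convergence we can use the values C_big = 0.475, C_sat = 0.3, C_add = 0.615. These values were obtained by a series of numerical
experiments on 4-loop Feynman graphs." (eq_mc_constants, l.809–814) with the footnote "At the present moment, there is no mathematical proof
that (eq_deg) does not lead to case 3 [V(f,g) infinite] from Section III.A" (l.806–808). PRD 98 §III: "Deg(s) = C_bigZ + (C_bigF − C_bigZ)
N_L(s)/N_L(G), if s contain all electron lines of G; C_add + min_{F∈𝔉_max[G]} Σ_{G′∈F} max(0, −ω*_{G′/F}(s) − D_sub[G′]) otherwise, where
D_sub[G′] = C_subI if G′ ∈ 𝕴[G]; C_subSE if G′ is a self-energy subgraph; C_subO in the other cases" and (eq_mc_constants) "C_bigZ = 0.256,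
C_bigF = 0.839, C_add = 0.786, C_subI = 0.2, C_subSE = 0, C_subO = 0.2" (`amm4gpu_arxiv.tex` l.622–648).

MODEL (graphs without lepton loops). The electron path is the vertex sequence 0, 1, …, nv − 1 (the figures' a, b, c, …); a line is
`⟨id, el, a, b⟩` (el = electron/photon, endpoints a, b); `ext` is the vertex carrying the external photon. A subgraph "containing all lines
connecting the vertexes" (PRD 96 §II.A footnote) is an interval of vertices [p, q]; it is an electron SELF-ENERGY subgraph iff it is
one-particle irreducible, has no photon with exactly one end inside and does not contain `ext`; VERTEXLIKE iff one-particle irreducible with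
exactly one external photon (a one-ended photon, or `ext`); these are the UV-divergent subgraphs (no lepton loops ⇒ no photon self-energy /
light-by-light subgraphs). A derived graph G′/F (`Der`) is a vertex set with the list of its children; shrinking a child identifies its
vertices. N_L(s) = |s| + #components − #vertices (cyclomatic number). Everything is a computable function on `List ℕ` line-id sets, so the
printed examples are `decide`d.

What the kernel certifies (PRD 96 §III.B, every "For example" of the subsection): FIG. 4 (crossed ladder) the four printed I-closures and
𝔉_max[G] = {{G}}; FIG. 5 (SE-chains) ω′({2,4,7,9}) = ω({2,4,7,9,11,12,13,14}) = 2, 𝔖[G] = {{1,3,5},{6,8,10}}, the six printed ω* values,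
𝔉_max[G] = {{G,bc,de,gh,ij}}, Deg({1,3,5,6,8,10,11,12,13,14}) = C_add + max(C_sat, 4), Deg({1,…,10}) = C_big; FIG. 3 (overlapping
subgraphs) the five printed ω′_{G′/F} values, 𝔖[G] = {{2,9}}, the three printed ω* values, 𝔉_max[G] = {{G,cdef,cde},{G,cdef,def}},
Deg({3,7,5}) = C_add + max(C_sat, min(1/2, 3/2)), Deg({2,8,9}) = C_add + max(C_sat, 3/2), Deg({1,2,9}) = C_add + C_sat (C_sat ≥ 0),
Deg({1,2,3,4,5,6,9}) = C_big; FIG. 1: 𝕴[G] = {G, bcd}, "two other vertex-like UV-divergent subgraphs efg, fgh, one electron self-energy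
subgraph efgh", 𝔉_max[G] = {{G,bcd,efgh,efg},{G,bcd,efgh,fgh}} (PRD 96 §II, l.409–417, and l.750).
NOT claimed: anything about graphs WITH lepton loops (PRD 110 §IV.B's Deg₀ — a different, longer construction), about the integrals, or
about whether (eq_deg) yields finite variance (the paper itself: no proof).
-/

namespace Literature.MathematicalPhysics.QuantumFieldTheory.Volkov2017

/-! ## Graphs without lepton loops, line sets, ω -/

/-- An internal line: printed number `id`, `el` = electron (true) / photon (false), endpoints `a`, `b` = positions on the electron path.
[cite: Volkov2017, §III.B (l.604–617)] -/
structure Ln where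
  id : ℕ
  el : Bool
  a : ℕ
  b : ℕ
deriving DecidableEq, Repr

/-- An AMM graph without lepton loops: vertices 0 … nv−1 along the electron path, `ext` = the vertex of the external photon, the internal
lines. [cite: Volkov2017, §III.B (l.562–566 "not containing electron loops")] -/
structure Gr where
  nv : ℕ
  ext : ℕ
  lines : List Ln
deriving Repr

/-- Canonical form of a finite set of line numbers (sorted, duplicates removed). [cite: Volkov2017, §III.B] -/
def canon (xs : List ℕ) : List ℕ := (xs.eraseDups).insertionSort (· ≤ ·)

/-- The lines of G with numbers in s. [cite: Volkov2017, §III.B] -/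
def Gr.sub (G : Gr) (s : List ℕ) : List Ln := G.lines.filter fun l => decide (l.id ∈ s)

/-- Vertices incident to a list of lines. [cite: Volkov2017, §III.B] -/
def vertsOf (ls : List Ln) : List ℕ := canon (ls.foldr (fun l acc => l.a :: l.b :: acc) [])

/-- Merge step for connected components: the classes meeting the edge (a, b) are united. [cite: Volkov2017, §III.B ("independent loops")] -/
def mergeComp (cs : List (List ℕ)) (e : ℕ × ℕ) : List (List ℕ) :=
  let hit := cs.filter fun c => decide (e.1 ∈ c) || decide (e.2 ∈ c)
  let rest := cs.filter fun c => !(decide (e.1 ∈ c) || decide (e.2 ∈ c))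
  rest ++ [hit.foldr (· ++ ·) []]

/-- Connected components of the graph spanned by a list of lines. [cite: Volkov2017, §III.B] -/
def components (ls : List Ln) : List (List ℕ) :=
  (ls.map fun l => (l.a, l.b)).foldl mergeComp ((vertsOf ls).map fun v => [v])

/-- "N_L(s) is the number of independent loops in s": the cyclomatic number |s| + #components − #vertices. [cite: Volkov2017, §III.B (l.612–614)] -/
def nLoops (ls : List Ln) : ℕ := ls.length + (components ls).length - (vertsOf ls).length

/-- "ω(s) = 2N_L(s) + |electrons(s)|/2 − |s|". [cite: Volkov2017, §III.B (l.608–611)] -/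
def omegaL (ls : List Ln) : ℚ :=
  2 * (nLoops ls : ℚ) + ((ls.filter fun l => l.el).length : ℚ) / 2 - (ls.length : ℚ)

/-- ω(s) in the whole graph G. [cite: Volkov2017, §III.B (l.608–611)] -/
def Gr.omega (G : Gr) (s : List ℕ) : ℚ := omegaL (G.sub s)

/-- The electron path in G connecting the vertices u and v (as line numbers). [cite: Volkov2017, §III.B (l.619–622)] -/
def Gr.epath (G : Gr) (u v : ℕ) : List ℕ :=
  (G.lines.filter fun l => l.el && decide (min u v ≤ min l.a l.b) && decide (max l.a l.b ≤ max u v)).map fun l => l.id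

/-! ## Derived graphs G′/F, I-closure, ω′ -/

/-- A graph derived from G "by some operations like described above": the vertex set of a subgraph G′ together with the vertex sets of the
children of G′ in a forest F, which G′/F shrinks to points. [cite: Volkov2017, §III.B (l.645–662)] -/
structure Der where
  verts : List ℕ
  children : List (List ℕ)
deriving DecidableEq, Repr

/-- G itself as a derived graph (no children). [cite: Volkov2017, §III.B] -/
def Gr.whole (G : Gr) : Der := ⟨List.range G.nv, []⟩

/-- The point a vertex becomes in G′/F (a child is represented by its least vertex). [cite: Volkov2017, §III.B (l.650–652)] -/
def Der.rep (D : Der) (v : ℕ) : ℕ :=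
  match D.children.find? fun c => decide (v ∈ c) with
  | some c => c.foldl min v
  | none => v

/-- The internal lines of G′/F: lines of G with both ends in G′ and not inside a child, with their ends identified. [cite: Volkov2017, §III.B (l.650–662)] -/
def Gr.linesOf (G : Gr) (D : Der) : List Ln :=
  (G.lines.filter fun l => decide (l.a ∈ D.verts) && decide (l.b ∈ D.verts) &&
      !(D.children.any fun c => decide (l.a ∈ c) && decide (l.b ∈ c))).map
    fun l => { l with a := D.rep l.a, b := D.rep l.b }

/-- The line numbers of G′/F. [cite: Volkov2017, §III.B] -/
def Gr.idsOf (G : Gr) (D : Der) : List ℕ := (G.linesOf D).map fun l => l.id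

/-- "IClos(s) = s ∪ s′, where s′ is the set of all internal photon lines l … such that s contains the electron path … connecting the ends of
l", taken in the graph G′/F on s′ = s ∩ lines(G′/F) (the electron path of G′/F = the path of G without the lines inside children).
[cite: Volkov2017, §III.B (l.619–622, l.653–662)] -/
def Gr.iclosD (G : Gr) (D : Der) (s : List ℕ) : List ℕ :=
  let ids := G.idsOf D
  let s' := s.filter fun i => decide (i ∈ ids)
  let added := (G.lines.filter fun l => !l.el && decide (l.id ∈ ids) &&
      ((G.epath l.a l.b).filter fun i => decide (i ∈ ids)).all fun i => decide (i ∈ s')).map fun l => l.id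
  canon (s' ++ added)

/-- I-closure in the whole graph G. [cite: Volkov2017, §III.B (l.619–634)] -/
def Gr.iclos (G : Gr) (s : List ℕ) : List ℕ := G.iclosD G.whole s

/-- ω_{G′/F}(s): ω applied in G′/F to s ∩ lines(G′/F). [cite: Volkov2017, §III.B (l.653–662)] -/
def Gr.omegaD (G : Gr) (D : Der) (s : List ℕ) : ℚ := omegaL ((G.linesOf D).filter fun l => decide (l.id ∈ s))

/-- "ω′(s) = ω(IClos(s))", in G′/F. [cite: Volkov2017, §III.B (l.636–643, l.653–679)] -/
def Gr.omega' (G : Gr) (D : Der) (s : List ℕ) : ℚ := G.omegaD D (G.iclosD D s)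

/-! ## UV-divergent subgraphs, SE-chains, ω*, forests, Deg -/

/-- The vertex interval [p, q] of the electron path. [cite: Volkov2017, §II.A] -/
def ival (p q : ℕ) : List ℕ := (List.range (q + 1)).filter fun v => decide (p ≤ v)

/-- Is the vertex v inside [p, q]? [cite: Volkov2017, §II.A] -/
def inI (pq : ℕ × ℕ) (v : ℕ) : Bool := decide (pq.1 ≤ v) && decide (v ≤ pq.2)

/-- The lines of the subgraph on [p, q] ("contain all lines connecting the vertexes"). [cite: Volkov2017, §II.A] -/
def Gr.linesI (G : Gr) (pq : ℕ × ℕ) : List Ln := G.lines.filter fun l => inI pq l.a && inI pq l.b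

/-- Number of external photons of the subgraph on [p, q]: photons with exactly one end inside, plus the external photon of G if ext ∈ [p, q].
[cite: Volkov2017, §II.A] -/
def Gr.nGamma (G : Gr) (pq : ℕ × ℕ) : ℕ :=
  (G.lines.filter fun l => !l.el && (inI pq l.a != inI pq l.b)).length + (if inI pq G.ext then 1 else 0)

/-- One-particle irreducibility of the subgraph on [p, q]: it has an internal photon and every internal electron line is bridged by an
internal photon. [cite: Volkov2017, §II.A (UV-divergent subgraphs are 1PI)] -/
def Gr.onePI (G : Gr) (pq : ℕ × ℕ) : Bool :=
  let ph := (G.linesI pq).filter fun l => !l.el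
  decide (ph ≠ []) && ((G.linesI pq).filter fun l => l.el).all fun e =>
    ph.any fun f => decide (min f.a f.b ≤ min e.a e.b) && decide (max e.a e.b ≤ max f.a f.b)

/-- All proper vertex intervals [p, q], p < q, other than the whole path. [cite: Volkov2017, §II.A] -/
def Gr.ivals (G : Gr) : List (ℕ × ℕ) :=
  ((List.range G.nv).foldr (fun p acc => ((List.range G.nv).filter fun q => decide (p < q)).map (fun q => (p, q)) ++ acc) []).filter
    fun pq => !(decide (pq.1 = 0) && decide (pq.2 + 1 = G.nv))

/-- Electron self-energy subgraphs of G (1PI, no external photon), as vertex intervals. [cite: Volkov2017, §II.A, §III.B (l.681–688)] -/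
def Gr.seSubs (G : Gr) : List (ℕ × ℕ) := G.ivals.filter fun pq => G.onePI pq && decide (G.nGamma pq = 0)

/-- Proper vertexlike (UV-divergent) subgraphs of G: 1PI with exactly one external photon. [cite: Volkov2017, §II.A] -/
def Gr.vxSubs (G : Gr) : List (ℕ × ℕ) := G.ivals.filter fun pq => G.onePI pq && decide (G.nGamma pq = 1)

/-- All proper UV-divergent subgraphs (no lepton loops ⇒ self-energy or vertexlike). [cite: Volkov2017, §II.A] -/
def Gr.uvSubs (G : Gr) : List (ℕ × ℕ) := G.ivals.filter fun pq => G.onePI pq && decide (G.nGamma pq ≤ 1)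

/-- 𝕴[G] ∖ {G}: the proper vertexlike subgraphs containing the vertex of the external photon. [cite: Volkov2017, §II.B (l.409–413)] -/
def Gr.infraSubs (G : Gr) : List (ℕ × ℕ) := G.vxSubs.filter fun pq => inI pq G.ext

/-- The whole graph as an interval. [cite: Volkov2017, §II.A] -/
def Gr.top (G : Gr) : ℕ × ℕ := (0, G.nv - 1)

/-- The links "l_j G_j l_{j+1}" of the chains: for each electron self-energy subgraph [p, q], the electron line entering p and the one
leaving q. [cite: Volkov2017, §III.B (l.681–688)] -/
def Gr.seLinks (G : Gr) : List Ln :=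
  G.seSubs.filterMap fun pq =>
    match G.lines.find? (fun l => l.el && decide (max l.a l.b = pq.1)), G.lines.find? (fun l => l.el && decide (min l.a l.b = pq.2)) with
    | some i, some o => some ⟨0, true, i.id, o.id⟩
    | _, _ => none

/-- "𝔖[G]": the SE-chains = maximal line sets {l₁,…,l_{r+1}} of chains l₁G₁l₂…G_rl_{r+1} (connected classes of the link relation).
[cite: Volkov2017, §III.B (l.681–697)] -/
def Gr.seChains (G : Gr) : List (List ℕ) := ((components G.seLinks).map canon).insertionSort (· ≤ ·)

/-- "ω*_{G′}(s) = ω′_{G′}(s) + ½ Σ_{s′∈𝔖[G], s′⊆s, s′ in G′} (|s′| − 1)" (SE-chains of the WHOLE graph G; "in G′" = all its lines are lines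
of G′/F). [cite: Volkov2017, §III.B (l.699–735)] -/
def Gr.omegaStar (G : Gr) (D : Der) (s : List ℕ) : ℚ :=
  let ids := G.idsOf D
  G.omega' D s + ((G.seChains.filter fun c => c.all fun i => decide (i ∈ s) && decide (i ∈ ids)).map
      fun c => ((c.length : ℚ) - 1) / 2).sum

/-- Two subgraphs overlap: neither contains the other and their line sets intersect. [cite: Volkov2017, §II.A] -/
def Gr.overlap (G : Gr) (I J : ℕ × ℕ) : Bool :=
  !(decide (I.1 ≤ J.1) && decide (J.2 ≤ I.2)) && !(decide (J.1 ≤ I.1) && decide (I.2 ≤ J.2)) &&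
    (G.linesI I).any fun l => inI J l.a && inI J l.b

/-- "𝔉_max[G]": the maximal forests of UV-divergent subgraphs containing G (each listed as G followed by its proper members).
[cite: Volkov2017, §III.B (l.745–754)] -/
def Gr.maxForests (G : Gr) : List (List (ℕ × ℕ)) :=
  let fs := G.uvSubs.sublists.filter fun F =>
    F.all fun I => F.all fun J => !G.overlap I J
  (fs.filter fun F => fs.all fun F' => !(F.all fun I => decide (I ∈ F')) || decide (F'.length ≤ F.length)).map fun F => G.top :: F

/-- The children of G′ in F (maximal members of F properly inside G′) and the derived graph G′/F. [cite: Volkov2017, §III.B (l.645–652)] -/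
def Gr.der (G : Gr) (I : ℕ × ℕ) (F : List (ℕ × ℕ)) : Der :=
  let inside := F.filter fun J => decide (I.1 ≤ J.1) && decide (J.2 ≤ I.2) && decide (J ≠ I)
  let maximal := inside.filter fun J => inside.all fun K => !(decide (K.1 ≤ J.1) && decide (J.2 ≤ K.2) && decide (K ≠ J))
  ⟨if I = G.top then List.range G.nv else ival I.1 I.2, maximal.map fun J => ival J.1 J.2⟩

/-- Σ_{G′∈F} max(0, −ω*_{G′/F}(s) − d(G′)) for one forest (d = the PRD 98 shift D_sub, zero in PRD 96). [cite: Volkov2017, §III.B (eq_deg)] -/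
def Gr.forestSum (G : Gr) (d : ℕ × ℕ → ℚ) (F : List (ℕ × ℕ)) (s : List ℕ) : ℚ :=
  (F.map fun I => max 0 (-(G.omegaStar (G.der I F) s) - d I)).sum

/-- Minimum of a nonempty list of rationals (0 on the empty list). [cite: Volkov2017, §III.B (eq_deg)] -/
def lmin : List ℚ → ℚ
  | [] => 0
  | x :: xs => xs.foldl min x

/-- "min_{F∈𝔉_max[G]} Σ_{G′∈F} max(0, −ω*_{G′/F}(s))" — the combinatorial core of (eq_deg). [cite: Volkov2017, §III.B (eq_deg, l.756–766)] -/
def Gr.degCore (G : Gr) (s : List ℕ) : ℚ := lmin (G.maxForests.map fun F => G.forestSum (fun _ => 0) F s)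

/-- Does s contain all electron lines of G? [cite: Volkov2017, §III.B (eq_deg)] -/
def Gr.allElectrons (G : Gr) (s : List ℕ) : Bool := (G.lines.filter fun l => l.el).all fun l => decide (l.id ∈ s)

/-- (eq_deg): "Deg(s) = C_big, if s contain all electron lines of G; C_add + max[C_sat, min_{F∈𝔉_max[G]} Σ_{G′∈F} max(0, −ω*_{G′/F}(s))]
otherwise." [cite: Volkov2017, §III.B (eq_deg, l.756–766)] -/
def Gr.deg17 (G : Gr) (Cbig Cadd Csat : ℚ) (s : List ℕ) : ℚ :=
  if G.allElectrons s then Cbig else Cadd + max Csat (G.degCore s)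

/-- PRD 96 (eq_mc_constants): "C_big = 0.475, C_sat = 0.3, C_add = 0.615" — the paper's own sampler parameters. [cite: Volkov2017, §III.B (eq_mc_constants, l.809–814)] -/
def K17 : ℚ × ℚ × ℚ := ((0.475 : ℚ), (0.3 : ℚ), (0.615 : ℚ))

/-- PRD 98 §III: "D_sub[G′] = C_subI, if G′ ∈ 𝕴[G]; C_subSE, if G′ is a self-energy subgraph; C_subO in the other cases."
[cite: Volkov2018, §III (l.633–637)] -/
def Gr.dSub (G : Gr) (CsubI CsubSE CsubO : ℚ) (I : ℕ × ℕ) : ℚ :=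
  if I = G.top ∨ (inI I G.ext && decide (G.nGamma I = 1)) then CsubI
  else if G.nGamma I = 0 then CsubSE else CsubO

/-- PRD 98 §III: "Deg(s) = C_bigZ + (C_bigF − C_bigZ) N_L(s)/N_L(G), if s contain all electron lines of G; C_add +
min_{F∈𝔉_max[G]} Σ_{G′∈F} max(0, −ω*_{G′/F}(s) − D_sub[G′]) otherwise." (The printed constants (eq_mc_constants) of PRD 98 are typed as
`Volkov2024.SamplingDensityParameters.K18`.) [cite: Volkov2018, §III (l.622–637)] -/
def Gr.deg18 (G : Gr) (CbigZ CbigF Cadd CsubI CsubSE CsubO : ℚ) (s : List ℕ) : ℚ :=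
  if G.allElectrons s then CbigZ + (CbigF - CbigZ) * (nLoops (G.sub s) : ℚ) / (nLoops G.lines : ℚ)
  else Cadd + lmin (G.maxForests.map fun F => G.forestSum (G.dSub CsubI CsubSE CsubO) F s)

/-! ## The four example graphs of PRD 96 (vertex a = 0, b = 1, …; printed line numbers) -/

/-- FIG. 4 `example_cross`, "3-loop fully crossed ladder": path a…g, external photon at d; electron lines 1–6 = ab, bc, cd, de, ef, fg;
photons 7 = ae, 8 = bf, 9 = cg. [cite: Volkov2017, §III.B FIG. 4 (l.823–828)] -/
def figCross : Gr := ⟨7, 3, [⟨1, true, 0, 1⟩, ⟨2, true, 1, 2⟩, ⟨3, true, 2, 3⟩, ⟨4, true, 3, 4⟩, ⟨5, true, 4, 5⟩, ⟨6, true, 5, 6⟩,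
  ⟨7, false, 0, 4⟩, ⟨8, false, 1, 5⟩, ⟨9, false, 2, 6⟩]⟩

/-- FIG. 3 `example_select`, "overlapping UV-divergent subgraphs": path a…g, external photon at b; electron lines 1 = ab, 2 = bc, 3 = cd,
4 = de, 5 = ef, 9 = fg; photons 6 = ce, 7 = df, 8 = ag. [cite: Volkov2017, §III.B FIG. 3 (l.816–821)] -/
def figSelect : Gr := ⟨7, 1, [⟨1, true, 0, 1⟩, ⟨2, true, 1, 2⟩, ⟨3, true, 2, 3⟩, ⟨4, true, 3, 4⟩, ⟨5, true, 4, 5⟩, ⟨9, true, 5, 6⟩,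
  ⟨6, false, 2, 4⟩, ⟨7, false, 3, 5⟩, ⟨8, false, 0, 6⟩]⟩

/-- FIG. 5 `example_chains`, "two SE-chains": path a…k, external photon at f; electron lines 1–10 = ab, …, jk; photons 11 = bc, 12 = de,
13 = gh, 14 = ij, 15 = ak. [cite: Volkov2017, §III.B FIG. 5 (l.830–835)] -/
def figChains : Gr := ⟨11, 5, [⟨1, true, 0, 1⟩, ⟨2, true, 1, 2⟩, ⟨3, true, 2, 3⟩, ⟨4, true, 3, 4⟩, ⟨5, true, 4, 5⟩, ⟨6, true, 5, 6⟩,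
  ⟨7, true, 6, 7⟩, ⟨8, true, 7, 8⟩, ⟨9, true, 8, 9⟩, ⟨10, true, 9, 10⟩,
  ⟨11, false, 1, 2⟩, ⟨12, false, 3, 4⟩, ⟨13, false, 6, 7⟩, ⟨14, false, 8, 9⟩, ⟨15, false, 0, 10⟩]⟩

/-- FIG. 1 `example_operators` (PRD 96 §II.B): path a…i, external photon at c; electron lines numbered 1–8 here (the figure prints no line
numbers), photons 9 = ai, 10 = bd, 11 = eg, 12 = fh. [cite: Volkov2017, §II.B FIG. 1 (l.409–427)] -/
def figOperators : Gr := ⟨9, 2, [⟨1, true, 0, 1⟩, ⟨2, true, 1, 2⟩, ⟨3, true, 2, 3⟩, ⟨4, true, 3, 4⟩, ⟨5, true, 4, 5⟩, ⟨6, true, 5, 6⟩,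
  ⟨7, true, 6, 7⟩, ⟨8, true, 7, 8⟩, ⟨9, false, 0, 8⟩, ⟨10, false, 1, 3⟩, ⟨11, false, 4, 6⟩, ⟨12, false, 5, 7⟩]⟩

/-! ### Named subgraphs (vertex intervals; a = 0, b = 1, …) -/

/-- FIG. 3: cdef = [2, 5], cde = [2, 4], def = [3, 5]. [cite: Volkov2017, §III.B (l.663)] -/
def cdef : ℕ × ℕ := (2, 5)
/-- FIG. 3: cde. [cite: Volkov2017, §III.B (l.663)] -/
def cde : ℕ × ℕ := (2, 4)
/-- FIG. 3: def. [cite: Volkov2017, §III.B (l.663)] -/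
def def_ : ℕ × ℕ := (3, 5)
/-- FIG. 5: bc, de, gh, ij. [cite: Volkov2017, §III.B (l.728)] -/
def bc : ℕ × ℕ := (1, 2)
/-- FIG. 5: de. [cite: Volkov2017, §III.B (l.728)] -/
def de : ℕ × ℕ := (3, 4)
/-- FIG. 5: gh. [cite: Volkov2017, §III.B (l.728)] -/
def gh : ℕ × ℕ := (6, 7)
/-- FIG. 5: ij. [cite: Volkov2017, §III.B (l.728)] -/
def ij : ℕ × ℕ := (8, 9)
/-- FIG. 1: bcd, efgh, efg, fgh. [cite: Volkov2017, §II.B (l.409–417)] -/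
def bcd : ℕ × ℕ := (1, 3)
/-- FIG. 1: efgh. [cite: Volkov2017, §II.B (l.409–417)] -/
def efgh : ℕ × ℕ := (4, 7)
/-- FIG. 1: efg. [cite: Volkov2017, §II.B (l.409–417)] -/
def efg : ℕ × ℕ := (4, 6)
/-- FIG. 1: fgh. [cite: Volkov2017, §II.B (l.409–417)] -/
def fgh : ℕ × ℕ := (5, 7)

/-! ## The printed examples, certified -/

/-- FIG. 4: "IClos({3,5,6}) = {3,5,6}, IClos({3,4,5,6}) = {3,4,5,6,9}, IClos({2,3,4,5,6,7}) = {2,3,4,5,6,7,8,9}, IClos({1,2,3,4,5,6}) =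
{1,2,3,4,5,6,7,8,9}." [cite: Volkov2017, §III.B (l.622–634)] -/
theorem figCross_iclos :
    figCross.iclos [3, 5, 6] = [3, 5, 6] ∧ figCross.iclos [3, 4, 5, 6] = [3, 4, 5, 6, 9] ∧
    figCross.iclos [2, 3, 4, 5, 6, 7] = [2, 3, 4, 5, 6, 7, 8, 9] ∧ figCross.iclos [1, 2, 3, 4, 5, 6] = [1, 2, 3, 4, 5, 6, 7, 8, 9] := by
  decide +kernel

/-- FIG. 4: "𝔉_max[G] = {{G}}" — the crossed ladder has no proper UV-divergent subgraph. [cite: Volkov2017, §III.B (l.752)] -/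
theorem figCross_maxForests : figCross.uvSubs = [] ∧ figCross.maxForests = [[figCross.top]] := by decide

/-- FIG. 5: "ω′({2,4,7,9}) = ω({2,4,7,9,11,12,13,14}) = 2". [cite: Volkov2017, §III.B (l.640–643)] -/
theorem figChains_omega' :
    figChains.iclos [2, 4, 7, 9] = [2, 4, 7, 9, 11, 12, 13, 14] ∧ figChains.omega [2, 4, 7, 9, 11, 12, 13, 14] = 2 ∧
    figChains.omega' figChains.whole [2, 4, 7, 9] = 2 := by
  decide +kernel

/-- FIG. 3 and FIG. 5: "𝔖[G] = {{2,9}}", "𝔖[G] = {{1,3,5},{6,8,10}}"; and the electron self-energy subgraphs behind them (cdef; bc, de, gh,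
ij). [cite: Volkov2017, §III.B (l.689–697)] -/
theorem seChains_examples :
    figSelect.seSubs = [cdef] ∧ figSelect.seChains = [[2, 9]] ∧
    figChains.seSubs = [bc, de, gh, ij] ∧ figChains.seChains = [[1, 3, 5], [6, 8, 10]] ∧
    figCross.seChains = [] := by
  decide +kernel

/-- FIG. 3, forests F₁ = {G, cdef, cde}, F₂ = {G, cdef, def}: "ω′_{cdef/F₁}({3,5,7}) = ω′_{cdef/F₁}({5,7}) = ω_{cdef/F₁}({5,7}) = 1/2,
ω′_{cde/F₁}({3,5,7}) = ω′_{cde/F₁}({3}) = ω_{cde/F₁}({3}) = −1/2, ω′_{cdef/F₂}({3,5,7}) = ω′_{cdef/F₂}({3}) = ω_{cdef/F₂}({3,6}) = 1/2,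
ω′_{def/F₂}({3,5,7}) = ω′_{def/F₂}({5,7}) = ω_{def/F₂}({5,7}) = −3/2, ω′_{G/F₁}({1,2,9}) = ω_{G/F₁}({1,2,8,9}) = −1/2."
[cite: Volkov2017, §III.B (l.662–679)] -/
theorem figSelect_omega'_quotients :
    let F₁ := [figSelect.top, cdef, cde]
    let F₂ := [figSelect.top, cdef, def_]
    figSelect.iclosD (figSelect.der cdef F₁) [3, 5, 7] = [5, 7] ∧ figSelect.omega' (figSelect.der cdef F₁) [3, 5, 7] = 1 / 2 ∧
    figSelect.iclosD (figSelect.der cde F₁) [3, 5, 7] = [3] ∧ figSelect.omega' (figSelect.der cde F₁) [3, 5, 7] = -1 / 2 ∧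
    figSelect.iclosD (figSelect.der cdef F₂) [3, 5, 7] = [3, 6] ∧ figSelect.omega' (figSelect.der cdef F₂) [3, 5, 7] = 1 / 2 ∧
    figSelect.iclosD (figSelect.der def_ F₂) [3, 5, 7] = [5, 7] ∧ figSelect.omega' (figSelect.der def_ F₂) [3, 5, 7] = -3 / 2 ∧
    figSelect.iclosD (figSelect.der figSelect.top F₁) [1, 2, 9] = [1, 2, 8, 9] ∧
    figSelect.omega' (figSelect.der figSelect.top F₁) [1, 2, 9] = -1 / 2 := by
  decide +kernel

/-- FIG. 3, F = {G, cdef}: "ω*_{G/F}({1,2,6,7,9}) = ω′_{G/F}({1,2,9}) + 1/2 = ω_{G/F}({1,2,8,9}) + 1/2 = 0, ω*_{cdef/F}({1,2,6,7,9}) =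
ω′_{cdef/F}({6,7}) = ω({6,7}) = −2, ω*_{G/F}({1,9}) = ω′_{G/F}({1,9}) = ω_{G/F}({1,9}) = −1." [cite: Volkov2017, §III.B (l.707–720)] -/
theorem figSelect_omegaStar :
    let F := [figSelect.top, cdef]
    figSelect.omega' (figSelect.der figSelect.top F) [1, 2, 6, 7, 9] = -1 / 2 ∧
    figSelect.omegaStar (figSelect.der figSelect.top F) [1, 2, 6, 7, 9] = 0 ∧
    figSelect.omega [6, 7] = -2 ∧ figSelect.omegaStar (figSelect.der cdef F) [1, 2, 6, 7, 9] = -2 ∧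
    figSelect.omegaD (figSelect.der figSelect.top F) [1, 9] = -1 ∧ figSelect.omegaStar (figSelect.der figSelect.top F) [1, 9] = -1 := by
  decide +kernel

/-- FIG. 5, F = {G, bc, de, gh, ij}: "ω*_G({1,5,8,10}) = ω′({1,5,8,10}) = ω({1,5,8,10}) = −2, ω*_G({1,3,5,8,10}) = 1 + ω′({1,3,5,8,10}) =
−3/2, ω*_G({1,5,6,8,10}) = 1 + ω′({1,5,6,8,10}) = −3/2, ω*_G({1,3,5,6,8,10}) = 2 + ω′({1,3,5,6,8,10}) = −1, ω*_{G/F}({1,3,5,6,8,10}) =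
2 + ω′_{G/F}({1,3,5,6,8,10}) = 2 − 2 = 0, ω*_{bc/F}({1,3,5,6,8,10}) = ω′_{bc/F}(∅) = ω(∅) = 0." [cite: Volkov2017, §III.B (l.721–735)] -/
theorem figChains_omegaStar :
    let F := [figChains.top, bc, de, gh, ij]
    figChains.omega [1, 5, 8, 10] = -2 ∧ figChains.omegaStar figChains.whole [1, 5, 8, 10] = -2 ∧
    figChains.omega' figChains.whole [1, 3, 5, 8, 10] = -5 / 2 ∧ figChains.omegaStar figChains.whole [1, 3, 5, 8, 10] = -3 / 2 ∧
    figChains.omega' figChains.whole [1, 5, 6, 8, 10] = -5 / 2 ∧ figChains.omegaStar figChains.whole [1, 5, 6, 8, 10] = -3 / 2 ∧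
    figChains.omega' figChains.whole [1, 3, 5, 6, 8, 10] = -3 ∧ figChains.omegaStar figChains.whole [1, 3, 5, 6, 8, 10] = -1 ∧
    figChains.omega' (figChains.der figChains.top F) [1, 3, 5, 6, 8, 10] = -2 ∧
    figChains.omegaStar (figChains.der figChains.top F) [1, 3, 5, 6, 8, 10] = 0 ∧
    figChains.iclosD (figChains.der bc F) [1, 3, 5, 6, 8, 10] = [] ∧ figChains.omegaStar (figChains.der bc F) [1, 3, 5, 6, 8, 10] = 0 := by
  decide +kernel

/-- "𝔉_max[G] = {{G,bcd,efgh,efg},{G,bcd,efgh,fgh}}, {{G,cdef,cde},{G,cdef,def}}, {{G}}, {{G,bc,de,gh,ij}}" for FIG. 1, 3, 4, 5, together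
with the UV-divergent subgraphs behind them (FIG. 1: "𝕴[G] = {G, bcd} … two other vertex-like UV-divergent subgraphs efg, fgh, one electron
self-energy subgraph efgh"; FIG. 3: cde, def vertexlike and overlapping, cdef self-energy). [cite: Volkov2017, §II.B (l.409–417), §III.B (l.745–754)] -/
theorem maxForests_examples :
    figOperators.infraSubs = [bcd] ∧ figOperators.vxSubs = [bcd, efg, fgh] ∧ figOperators.seSubs = [efgh] ∧
    figOperators.maxForests = [[figOperators.top, bcd, efg, efgh], [figOperators.top, bcd, efgh, fgh]] ∧
    figSelect.vxSubs = [cde, def_] ∧ figSelect.overlap cde def_ = true ∧ figSelect.infraSubs = [] ∧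
    figSelect.maxForests = [[figSelect.top, cde, cdef], [figSelect.top, cdef, def_]] ∧
    figCross.maxForests = [[figCross.top]] ∧
    figChains.maxForests = [[figChains.top, bc, de, gh, ij]] := by
  decide +kernel

/-- FIG. 3, the combinatorial cores of the printed Deg values: min(1/2, 3/2) = 1/2 for {3,7,5} (the two forest sums ARE 1/2 and 3/2), 3/2 for
{2,8,9}, 0 for {1,2,9}; and {1,2,3,4,5,6,9} contains all electron lines. [cite: Volkov2017, §III.B (l.767–786)] -/
theorem figSelect_degCore :
    figSelect.forestSum (fun _ => 0) [figSelect.top, cde, cdef] [3, 7, 5] = 1 / 2 ∧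
    figSelect.forestSum (fun _ => 0) [figSelect.top, cdef, def_] [3, 7, 5] = 3 / 2 ∧
    figSelect.degCore [3, 7, 5] = 1 / 2 ∧ figSelect.degCore [2, 8, 9] = 3 / 2 ∧ figSelect.degCore [1, 2, 9] = 0 ∧
    figSelect.allElectrons [3, 7, 5] = false ∧ figSelect.allElectrons [2, 8, 9] = false ∧ figSelect.allElectrons [1, 2, 9] = false ∧
    figSelect.allElectrons [1, 2, 3, 4, 5, 6, 9] = true := by
  decide +kernel

/-- FIG. 3, as printed: "Deg({3,7,5}) = C_add + max(C_sat, min(1/2, 3/2)) = C_add + max(C_sat, 1/2), Deg({2,8,9}) = C_add + max(C_sat, 3/2),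
Deg({1,2,9}) = C_add + C_sat, Deg({1,2,3,4,5,6,9}) = C_big" (the third uses the standing hypothesis C_sat ≥ 0). [cite: Volkov2017, §III.B (l.767–786)] -/
theorem figSelect_deg (Cbig Cadd Csat : ℚ) (hsat : 0 ≤ Csat) :
    figSelect.deg17 Cbig Cadd Csat [3, 7, 5] = Cadd + max Csat (min (1 / 2) (3 / 2)) ∧
    figSelect.deg17 Cbig Cadd Csat [2, 8, 9] = Cadd + max Csat (3 / 2) ∧
    figSelect.deg17 Cbig Cadd Csat [1, 2, 9] = Cadd + Csat ∧
    figSelect.deg17 Cbig Cadd Csat [1, 2, 3, 4, 5, 6, 9] = Cbig := by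
  obtain ⟨_, _, h1, h2, h3, e1, e2, e3, e4⟩ := figSelect_degCore
  simp only [Gr.deg17, e1, e2, e3, e4, h1, h2, h3, Bool.false_eq_true, if_false, if_true, max_eq_left hsat]
  norm_num

/-- FIG. 5, F = {G, bc, de, gh, ij} the only maximal forest: the core of "Deg({1,3,5,6,8,10,11,12,13,14}) = C_add + max(C_sat, 0+1+1+1+1)"
term by term, and {1,…,10} = all electron lines. [cite: Volkov2017, §III.B (l.787–794)] -/
theorem figChains_degCore :
    let F := [figChains.top, bc, de, gh, ij]
    let s := [1, 3, 5, 6, 8, 10, 11, 12, 13, 14]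
    max 0 (-(figChains.omegaStar (figChains.der figChains.top F) s)) = 0 ∧
    max 0 (-(figChains.omegaStar (figChains.der bc F) s)) = 1 ∧ max 0 (-(figChains.omegaStar (figChains.der de F) s)) = 1 ∧
    max 0 (-(figChains.omegaStar (figChains.der gh F) s)) = 1 ∧ max 0 (-(figChains.omegaStar (figChains.der ij F) s)) = 1 ∧
    figChains.degCore s = 4 ∧ figChains.allElectrons s = false ∧
    figChains.allElectrons [1, 2, 3, 4, 5, 6, 7, 8, 9, 10] = true := by
  decide +kernel

/-- FIG. 5, as printed: "Deg({1,3,5,6,8,10,11,12,13,14}) = C_add + max(C_sat, 4), Deg({1,2,3,4,5,6,7,8,9,10}) = C_big".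
[cite: Volkov2017, §III.B (l.787–794)] -/
theorem figChains_deg (Cbig Cadd Csat : ℚ) :
    figChains.deg17 Cbig Cadd Csat [1, 3, 5, 6, 8, 10, 11, 12, 13, 14] = Cadd + max Csat 4 ∧
    figChains.deg17 Cbig Cadd Csat [1, 2, 3, 4, 5, 6, 7, 8, 9, 10] = Cbig := by
  obtain ⟨_, _, _, _, _, h, e1, e2⟩ := figChains_degCore
  simp only [Gr.deg17, e1, e2, h, Bool.false_eq_true, if_false, if_true, and_self]

/-- The printed ω(s) on the example graphs' UV-divergent subgraphs and on the whole graphs: 1/2 on every electron self-energy subgraph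
(cdef; bc, de, gh, ij; efgh), 0 on every vertexlike one (cde, def; bcd, efg, fgh) and 0 on each whole graph — i.e. one half of §II.A's
ω(G′) = 4 − N_γ − (3/2)N_e (= 1, 0, 0), the Feynman-parametric normalisation (2E_e + N_e = 2V, 2E_γ + N_γ = V, N_L = E − V + 1 give
2N_L + E_e/2 − E = ½(4 − N_γ − (3/2)N_e) for any subgraph); the printed sentence reads "then ω(s) coincides with the ultraviolet degree of
divergence of this subgraph". [cite: Volkov2017, §III.B (l.614–617), §II.A (l.274–277)] -/
theorem omega_on_uvSubgraphs :
    ([cdef].map fun I => omegaL (figSelect.linesI I)) = [1 / 2] ∧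
    ([cde, def_].map fun I => omegaL (figSelect.linesI I)) = [0, 0] ∧
    ([bc, de, gh, ij].map fun I => omegaL (figChains.linesI I)) = [1 / 2, 1 / 2, 1 / 2, 1 / 2] ∧
    ([efgh].map fun I => omegaL (figOperators.linesI I)) = [1 / 2] ∧
    ([bcd, efg, fgh].map fun I => omegaL (figOperators.linesI I)) = [0, 0, 0] ∧
    omegaL figCross.lines = 0 ∧ omegaL figSelect.lines = 0 ∧ omegaL figChains.lines = 0 ∧ omegaL figOperators.lines = 0 := by
  decide +kernel

end Literature.MathematicalPhysics.QuantumFieldTheory.Volkov2017
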